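import Summits.BirchSwinnertonDyer.Rank1Residual.X11b.CastellaErratum
import Summits.BirchSwinnertonDyer.Rank1Residual.Partition.Rows
import Literature.NumberTheory.EllipticCurves.Rank1Residual.X9NoEntry
import HarnessLib

/-!
# Route `ErratumRoadFive` (rung K2), crux `NonSurjCorner` (item stmt-BirchSwinnertonDyer-19065): a TYPED OBSTRUCTION —
# Castella's erratum data are VOID on the corner (no corner pair satisfies the erratum's hypothesis (iii) ∕ the
# A′-locus, over any field), so no «erratum-members» rung or frame can be instantiated at a corner pair
# (cell `bsd-stepL`, seat `bsd-stepL-corner5-p2` g0, WIDTH-LEVER lane B; `--supports stmt-BirchSwinnertonDyer-19065 --as helper`)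

WHY THIS FILE. The second prover lane on the corner was briefed to build «per-class certificates consuming the landed
Castella 2018 erratum-members facts by name» (director-bsd, 2026-08-27T10:49Z). Those facts — the OPEN member package
`Castella2018.erratum_members_exists_isTorsion_charIdeal_le_congruence_OPEN` (`Literature/…/Castella2018/ErratumHidaMembersCongruence.lean`),
the erratum Thm. 1.1 ∕ A′ statements, and every `ErratumHypotheses` ∕ `ChainLocus` frame of the route (x11b's
`X11b/CastellaErratum.lean`) — all carry the erratum's hypothesis (iii) «`E` has non-split multiplicative reduction at some
prime `q ≠ p` where `E[p]` is ramified» (`¬ p ∣ ord_q Δ_min`), i.e. a (ram) witness. A corner pair has `E[p]` irreducible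
and `ρ̄_{E,p}` NOT onto, hence (Serre 1972 Prop. 15 + Tate curve at `q ≠ p`, tree theorem
`Rank1Residual.not_ram_of_irr_of_not_surj`) NO (ram) witness. This file records the obstruction as kernel theorems, so
that the road is not re-attempted:

* `not_erratumHypotheses_of_irr_of_not_surj` — `Irr W p → ¬ Surj W p → ¬ X11b.ErratumHypotheses W p`;
* `not_chainLocus_of_irr_of_not_surj` — the same for the route-R1 population `X11b.ChainLocus`;
* `not_erratumMemberHypIII_of_irr_of_not_surj` — the member package's binder (iii) VERBATIM (over an arbitrary number
  field `K` in which `p` splits into two primes) is unsatisfiable;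
* `NonSurjCorner.erratumData_void` — at every pair in the corner's hypothesis list (`ClassX11b W p ∧ ¬ Surj W p`), all three.

HONEST FRAMING: theorems only (no definition, no named fact, no `sorry`); a NEGATIVE ∕ obstruction record about the
shape of a road, not about BSD; it asserts nothing about the truth of the member package or of the crux; nothing is
booked; `NonSurjCorner` stays OPEN. Memo: HOME/corner5/g0/CORNER5-P2-G0.md §0 (F1).

References: [Castella2018Erratum] Thm. 1.1 hypotheses (i)–(iv) (p. 1); [Serre1972] §2.4 Prop. 15; [SilvermanATAEC1994]
V.4–V.5, Ex. 5.13(b); tree: `Rank1Residual/X9NoEntry.lean` (`surj_of_irr_of_ram`, `not_ram_of_irr_of_not_surj`),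
`Rank1Residual/Typed/X11Three.lean` (`X11.ram_of_aprimeLocusAt`), `X11b/CastellaErratum.lean`.
-/

set_option linter.dupNamespace false
set_option autoImplicit false

noncomputable section

open scoped Classical

open WeierstrassCurve NumberField Literature.NumberTheory.EllipticCurves
  Literature.NumberTheory.EllipticCurves.Rank1Residual
  Literature.NumberTheory.EllipticCurves.Rank1Residual.Typed
  Summit.BirchSwinnertonDyer.Rank1Residual Summit.BirchSwinnertonDyer.Rank1Residual.X11b

namespace Summit.BirchSwinnertonDyer.BirchSwinnertonDyer.Theorems.CornerSeven

variable (W : WeierstrassCurve ℚ) [W.IsElliptic] [W.IsGloballyMinimal] (p : ℕ) [Fact p.Prime]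

/-- **No corner pair satisfies the erratum's Thm. A′ hypotheses** (`X11b.ErratumHypotheses = 5 ≤ p ∧ Mult ∧ Irr ∧
A′-locus`): the A′-locus contains a (ram) witness (`X11.ram_of_aprimeLocusAt`), impossible when `E[p]` is irreducible and
`ρ̄_{E,p}` is not onto (`not_ram_of_irr_of_not_surj`). [cite: Serre1972, §2.4 Prop. 15] [cite: Castella2018Erratum, Thm. 1.1 (iii) (p. 1)] -/
theorem not_erratumHypotheses_of_irr_of_not_surj (hirr : Irr W p) (hns : ¬ Surj W p) :
    ¬ X11b.ErratumHypotheses W p :=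
  fun h ↦ not_ram_of_irr_of_not_surj W p hirr hns (X11.ram_of_aprimeLocusAt h.2.2.2)

/-- **No corner pair lies in the route-R1 population `X11b.ChainLocus`** (which refines the A′-hypotheses).
[cite: Serre1972, §2.4 Prop. 15] [cite: Castella2018, §5 (arXiv:1704.06608 p. 12)] -/
theorem not_chainLocus_of_irr_of_not_surj (hirr : Irr W p) (hns : ¬ Surj W p) : ¬ X11b.ChainLocus W p :=
  fun h ↦ not_ram_of_irr_of_not_surj W p hirr hns (X11.ram_of_aprimeLocusAt h.erratumHypotheses.2.2.2)

/-- **The member package's hypothesis (iii) is unsatisfiable on the corner.** Binder (iii) of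
`Castella2018.erratum_members_exists_isTorsion_charIdeal_le_congruence_OPEN`, verbatim — «`∃ q ∥ N`, `q` NOT split in `K`,
`¬ p ∣ ord_q Δ_min`» — over any number field `K` in which `p` has exactly two primes (the package's splitting binder):
such a `q` is `≠ p` and is a (ram) witness, impossible for irreducible non-surjective `ρ̄_{E,p}`.
[cite: Castella2018Erratum, Thm. 1.1 (iii) (p. 1)] [cite: Serre1972, §2.4 Prop. 15] -/
theorem not_erratumMemberHypIII_of_irr_of_not_surj (hirr : Irr W p) (hns : ¬ Surj W p)
    (K : Type) [Field K] [NumberField K]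
    (hsplit : ((Ideal.span {(p : ℤ)}).primesOver (𝓞 K)).ncard = 2) :
    ¬ ∃ (q : ℕ) (_ : Fact q.Prime), Mult W q ∧ ((Ideal.span {(q : ℤ)}).primesOver (𝓞 K)).ncard ≠ 2 ∧
      ¬ p ∣ padicValInt q W.minimalDiscriminantInt := by
  rintro ⟨q, hq, hmult, hnsplit, hv⟩
  have hqp : q ≠ p := by
    rintro rfl
    exact hnsplit hsplit
  exact not_ram_of_irr_of_not_surj W p hirr hns ⟨q, hq, hqp, hmult, hv⟩

/-- **ERRATUM DATA ARE VOID ON THE CORNER** — at every pair in the hypothesis list of the crux `NonSurjCorner`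
(`ClassX11b W p`, `ρ̄_{E,p}` not onto): no A′-hypotheses, no route-R1 population membership, no member-package binder
(iii) over any `K` with `p` split. (The crux's further binders `p ∈ {5,7}`, `p ∣ ord_p Δ_min`, `¬ Ram` are not needed.)
[cite: Castella2018Erratum, Thm. 1.1 (iii) (p. 1)] [cite: Serre1972, §2.4 Prop. 15] -/
theorem NonSurjCorner.erratumData_void (hX : ClassX11b W p) (hns : ¬ Surj W p) :
    ¬ X11b.ErratumHypotheses W p ∧ ¬ X11b.ChainLocus W p ∧
      ∀ (K : Type) [Field K] [NumberField K], ((Ideal.span {(p : ℤ)}).primesOver (𝓞 K)).ncard = 2 →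
        ¬ ∃ (q : ℕ) (_ : Fact q.Prime), Mult W q ∧ ((Ideal.span {(q : ℤ)}).primesOver (𝓞 K)).ncard ≠ 2 ∧
          ¬ p ∣ padicValInt q W.minimalDiscriminantInt :=
  ⟨not_erratumHypotheses_of_irr_of_not_surj W p hX.2.2.2 hns,
    not_chainLocus_of_irr_of_not_surj W p hX.2.2.2 hns,
    fun K _ _ hsplit ↦ not_erratumMemberHypIII_of_irr_of_not_surj W p hX.2.2.2 hns K hsplit⟩

end Summit.BirchSwinnertonDyer.BirchSwinnertonDyer.Theorems.CornerSeven

end
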